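import Mathlib.Data.Real.Basic
import Mathlib.Data.Matrix.Mul
import Mathlib.Algebra.BigOperators.Fin
import Mathlib.Algebra.BigOperators.Intervals
import Mathlib.Data.List.GetD
import Literature.Computation.Certificates.Data
import HarnessLib

/-!
# List-level evaluation of the quadratic form of a literal rational matrix (tool; linear in the number of listed entries)

Cell `pub-turb` / `turb-bounds`, v2 tooling (pub-turb-cert gen 7, prover-pub-turb-cert-g7-0). The structured piece identities of the tail lemma
(`quadForm_<piece> : xᵀ·P·x = Legendre–Galerkin form`, LEAN-MAP data item (a)) were proved by expanding `x ⬝ᵥ (P.map cast *ᵥ x)` with `simp` over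
ALL `n²` index pairs (`Fin.sum_univ_succ` + positional `List.getD` lookups): 2.5 s at dim 18, 55 s at dim 53, 117–185 s at dim 62 per piece — too slow
beyond dim ≈ 70. This file proves ONCE that the quadratic form of `matrixOfRows n n rows` equals a structural recursion over the row lists
(`rowsEval`, one pass over the listed entries; trailing zeros may be dropped from the rows), so that `simp only [rowsEval, rowEval, <row defs>]`
unfolds it in time linear in the number of listed entries:
* `rowEval row y k = Σ_t row[t]·y(k+t)`, `rowsEval rows y i = Σ_r y(i+r)·rowEval rows[r] y 0` (definitions by structural recursion);
* `rowEval_eq_sum`, `rowsEval_eq_sum` (their meaning as finite sums);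
* `sum_range_eq_foldr` : `Σ_{i<n} f i` as a `List.foldr` over `List.range' 0 n` (linear unrolling for the generated coupling-mode files);
* `dotProduct_mulVec_eq_rowsEval` : for `x : Fin n → ℝ` and any extension `e : ℕ → ℝ` of `x` by zero (`e i = x i` for `i < n`, `e k = 0` for `k ≥ n`),
  `x ⬝ᵥ ((matrixOfRows n n rows).map Rat.cast *ᵥ x) = rowsEval rows e 0` — for EVERY `rows` (rows or entries beyond `n` are cut off by `e = 0`,
  missing ones are `0` by `List.getD`).
No new trusted surface: pure list/`Finset` algebra. HONEST FRAMING: rigorous bounds for the stated PDE and boundary conditions; no claim about physical turbulence beyond the bound.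
-/

set_option linter.style.longLine false

namespace Summit.NavierStokesRegularity.TurbBounds.QuadFormEval

open Finset Matrix Literature.Computation.Certificates

/-- `rowEval row y k = Σ_{t < |row|} row[t] · y (k + t)`: one rational row dotted into a real sequence read from position `k`. -/
def rowEval : List ℚ → (ℕ → ℝ) → ℕ → ℝ
  | [], _, _ => 0
  | q :: qs, y, k => (q : ℝ) * y k + rowEval qs y (k + 1)

/-- `rowsEval rows y i = Σ_{r < |rows|} y (i + r) · rowEval rows[r] y 0`: the quadratic form, row by row. -/
def rowsEval : List (List ℚ) → (ℕ → ℝ) → ℕ → ℝ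
  | [], _, _ => 0
  | r :: rs, y, i => y i * rowEval r y 0 + rowsEval rs y (i + 1)

/-- `rowEval` of the empty row. -/
@[simp] theorem rowEval_nil (y : ℕ → ℝ) (k : ℕ) : rowEval [] y k = 0 := rfl
/-- `rowEval` of a nonempty row. -/
@[simp] theorem rowEval_cons (q : ℚ) (qs : List ℚ) (y : ℕ → ℝ) (k : ℕ) :
    rowEval (q :: qs) y k = (q : ℝ) * y k + rowEval qs y (k + 1) := rfl
/-- `rowsEval` of no rows. -/
@[simp] theorem rowsEval_nil (y : ℕ → ℝ) (i : ℕ) : rowsEval [] y i = 0 := rfl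
/-- `rowsEval` of a nonempty row list. -/
@[simp] theorem rowsEval_cons (r : List ℚ) (rs : List (List ℚ)) (y : ℕ → ℝ) (i : ℕ) :
    rowsEval (r :: rs) y i = y i * rowEval r y 0 + rowsEval rs y (i + 1) := rfl

/-- Meaning of `rowEval` as a finite sum. -/
theorem rowEval_eq_sum (row : List ℚ) (y : ℕ → ℝ) (k : ℕ) :
    rowEval row y k = ∑ t ∈ range row.length, ((row.getD t 0 : ℚ) : ℝ) * y (k + t) := by
  induction row generalizing k with
  | nil => simp
  | cons q qs ih =>
    rw [rowEval_cons, ih (k + 1), List.length_cons, sum_range_succ']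
    simp only [List.getD_cons_zero, List.getD_cons_succ, Nat.add_zero]
    rw [add_comm]
    congr 1
    refine sum_congr rfl fun t _ => ?_
    rw [show k + (t + 1) = k + 1 + t by omega]

/-- Meaning of `rowsEval` as a finite sum. -/
theorem rowsEval_eq_sum (rows : List (List ℚ)) (y : ℕ → ℝ) (i : ℕ) :
    rowsEval rows y i = ∑ r ∈ range rows.length, y (i + r) * rowEval (rows.getD r []) y 0 := by
  induction rows generalizing i with
  | nil => simp
  | cons r rs ih =>
    rw [rowsEval_cons, ih (i + 1), List.length_cons, sum_range_succ']
    simp only [List.getD_cons_zero, List.getD_cons_succ, Nat.add_zero]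
    rw [add_comm]
    congr 1
    refine sum_congr rfl fun t _ => ?_
    rw [show i + (t + 1) = i + 1 + t by omega]

/-- A sum over `range` does not see where a summand is cut once it vanishes: `Σ_{t<a} f = Σ_{t<b} f` if `f = 0` on `[a, ∞)` and on `[b, ∞)`. -/
theorem sum_range_eq_of_vanish {f : ℕ → ℝ} {a b : ℕ} (ha : ∀ t, a ≤ t → f t = 0) (hb : ∀ t, b ≤ t → f t = 0) :
    ∑ t ∈ range a, f t = ∑ t ∈ range b, f t := by
  rcases le_total a b with h | h
  · exact (Finset.eventually_constant_sum ha h).symm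
  · exact Finset.eventually_constant_sum hb h

/-- The row form on a sequence supported in `[0, n)`: `rowEval row y 0 = Σ_{j<n} row[j]·y j` (entries past the row are `0`, past `n` are killed by `y`). -/
theorem rowEval_eq_sum_range (row : List ℚ) {y : ℕ → ℝ} {n : ℕ} (hy : ∀ k, n ≤ k → y k = 0) :
    rowEval row y 0 = ∑ j ∈ range n, ((row.getD j 0 : ℚ) : ℝ) * y j := by
  rw [rowEval_eq_sum]
  simp only [Nat.zero_add]
  refine sum_range_eq_of_vanish (fun t ht => ?_) (fun t ht => ?_)
  · rw [List.getD_eq_default _ _ ht]; simp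
  · rw [hy t ht, mul_zero]

/-- **The quadratic form of a list-backed rational matrix IS the list recursion `rowsEval`.** For `x : Fin n → ℝ` and any extension
`e : ℕ → ℝ` of `x` by zero, `x ⬝ᵥ ((matrixOfRows n n rows).map Rat.cast *ᵥ x) = rowsEval rows e 0`. -/
theorem dotProduct_mulVec_eq_rowsEval {n : ℕ} (rows : List (List ℚ)) (x : Fin n → ℝ) (e : ℕ → ℝ)
    (he : ∀ i : Fin n, e i.val = x i) (hz : ∀ k, n ≤ k → e k = 0) :
    x ⬝ᵥ ((matrixOfRows n n rows).map (Rat.cast : ℚ → ℝ) *ᵥ x) = rowsEval rows e 0 := by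
  have he' : ∀ j : Fin n, x j = e j.val := fun j => (he j).symm
  -- Step 1: both sums over `Fin n`, with `x` replaced by `e ∘ val`
  have h1 : x ⬝ᵥ ((matrixOfRows n n rows).map (Rat.cast : ℚ → ℝ) *ᵥ x)
      = ∑ i : Fin n, e i.val * ∑ j : Fin n, (((rows.getD i.val []).getD j.val 0 : ℚ) : ℝ) * e j.val := by
    simp only [dotProduct, mulVec, Matrix.map_apply, matrixOfRows_apply, he']
  -- Step 2: pass to sums over `range n`
  have h2 : (∑ i : Fin n, e i.val * ∑ j : Fin n, (((rows.getD i.val []).getD j.val 0 : ℚ) : ℝ) * e j.val)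
      = ∑ i ∈ range n, e i * ∑ j ∈ range n, (((rows.getD i []).getD j 0 : ℚ) : ℝ) * e j := by
    rw [← Fin.sum_univ_eq_sum_range (fun i => e i * ∑ j ∈ range n, (((rows.getD i []).getD j 0 : ℚ) : ℝ) * e j) n]
    refine Finset.sum_congr rfl fun i _ => ?_
    rw [← Fin.sum_univ_eq_sum_range (fun j => (((rows.getD i.val []).getD j 0 : ℚ) : ℝ) * e j) n]
  rw [h1, h2]
  -- Step 3: inner sums are the row forms (support of `e` is `[0, n)`)
  have h3 : ∀ i, e i * ∑ j ∈ range n, (((rows.getD i []).getD j 0 : ℚ) : ℝ) * e j = e i * rowEval (rows.getD i []) e 0 := by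
    intro i; rw [rowEval_eq_sum_range _ hz]
  simp only [h3]
  -- Step 4: the outer sum may run over the rows instead of `range n`
  rw [rowsEval_eq_sum]
  simp only [Nat.zero_add]
  refine sum_range_eq_of_vanish (fun t ht => ?_) (fun t ht => ?_)
  · rw [hz t ht, zero_mul]
  · rw [List.getD_eq_default _ _ ht, rowEval_nil, mul_zero]

/-! ### A linear unrolling of `Finset.range` sums (used by the generated coupling-mode files: nested `sum_range_succ` unrolling is quadratic) -/

/-- `Σ_{i<n} f (s+i)` as a right fold over `List.range' s n` (unfolds in `n` linear `simp` steps). -/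
theorem sum_range_add_eq_foldr (f : ℕ → ℝ) : ∀ (s n : ℕ), ∑ i ∈ range n, f (s + i) = (List.range' s n).foldr (fun i acc => f i + acc) 0
  | s, 0 => by simp
  | s, n + 1 => by
    rw [sum_range_succ', List.range'_succ, List.foldr_cons, add_comm, Nat.add_zero]
    congr 1
    rw [← sum_range_add_eq_foldr f (s + 1) n]
    refine sum_congr rfl fun i _ => ?_
    rw [show s + (i + 1) = s + 1 + i by omega]

/-- `Σ_{i<n} f i = foldr` over `List.range' 0 n`. -/
theorem sum_range_eq_foldr (f : ℕ → ℝ) (n : ℕ) : ∑ i ∈ range n, f i = (List.range' 0 n).foldr (fun i acc => f i + acc) 0 := by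
  rw [← sum_range_add_eq_foldr f 0 n]
  simp only [Nat.zero_add]

end Summit.NavierStokesRegularity.TurbBounds.QuadFormEval
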